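import Literature.Geometry.Riemannian.RicciFlowSmoothExtension
import Literature.Analysis.Calculus.ContDiffUniformLimit
import HarnessLib

/-!
# The smooth limit metric `g' = lim_{t ↑ T} g(t)/(T − t)` (Hamilton 1982, §14 and §17)
(helper `helper_scaledLimit_metric`, layer S5a of stub `stub_smoothRoundLimit` of line
`margerin-cone-hamilton-rails`, crux `EntropyRung.ChangGurskyYang`, item stmt-SmoothPoincare4-10834)

Along a Ricci flow of Riemannian metrics `g(t)` on `[0, T)` on a closed manifold with
`4`-dimensional model, suppose that near every point `z`, in the chart centred at `z`, the scaled
chart representatives `G̃_t(y) = (T − t)⁻¹ G_t(y)` of `g(t)/(T − t)` are uniformly positive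
definite and, for every order `m`, UNIFORMLY CAUCHY IN `Cᵐ` on a ball `B(ẑ, r)` as `t ↑ T`
(the output of `helper_scaledChart_bounds`: Hamilton 1982, §17, Cor. 17.10, "the metrics
`g̃(t)` converge in `C^∞`"). Then there is a `C^∞` RIEMANNIAN METRIC `g'` on `M` whose chart
representatives are the `C^∞` limits of the `G̃_t`: `D^m G̃_t → D^m G'` uniformly on `B(ẑ, r)` as
`t ↑ T`, for every `m` (`helper_scaledLimit_metric`). This is Hamilton's Lemma 14.2 ("the metrics
`g(t)` … converge uniformly, together with all their derivatives, to a positive definite metric")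
in the un-normalised clothes of §17, and Topping's "the tensor `g(t)` may be extended … and the
`g(T)` which has been added will be a metric … smooth" (2006, p. 47), for the scaled family.

## Proof

* Analysis (`exists_contDiffOn_limit_of_uniformCauchySeqOn`): a family of `C^∞` maps on an open
  set, uniformly Cauchy in every `Cᵐ` along `𝓝[<] T`, converges with all derivatives, uniformly,
  to a `C^∞` limit — the tree's `Literature.Analysis.Calculus.ContDiffUniformLimit`
  (Dieudonné (8.6.3), iterated), specialised to the filter `𝓝[<] T`.
* Geometry: the limits `G'_z` of the representatives in the chart at `z` define ONE field of
  bilinear forms `v` on `TM` — its coefficients `v_x(X, Y) = lim (T − t)⁻¹ g_t(x)(X, Y)` are read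
  at the centre of the chart at `x` (`exists_field_of_tendsto_gramOpFamily`, as `limitVal` of
  `RicciFlowSmoothExtension.lean`), and the representative of `v` in ANY chart is the limit of the
  scaled representatives there (`chartRepRaw_eq_of_tendsto`: entries are fixed linear functions of
  the coefficients, and limits are unique). Hence `v` is `C^∞`
  (`contMDiffOn_totalSpaceMk_of_chartRepRaw`, Topping 2006, §1.2.3), symmetric, and positive
  definite (the uniform lower bound `λ‖w‖² ≤ G̃_t(ẑ)(w, w)` passes to the limit,
  `pos_of_tendsto_of_lowerBound`): a Riemannian metric `g'` with `chartRep g' z = G'_z` on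
  `B(ẑ, r)`.

## References

* R. S. Hamilton, *Three-manifolds with positive Ricci curvature*, J. Differential Geom. 17
  (1982) 255–306, §14, Lemma 14.2; §17, Cor. 17.10. [Hamilton1982]
* P. Topping, *Lectures on the Ricci flow*, LMS Lecture Note Series 325, CUP 2006, §1.2.3 and
  §5.3, proof of Thm. 5.3.1, p. 47. [Topping2006]
* J. Dieudonné, *Foundations of Modern Analysis* (1960), (8.6.3)–(8.6.4).
-/

noncomputable section

-- every `Summit.SmoothPoincare4.SmoothPoincare4.…` name repeats the summit = sub-problem segment (D-0017 layout)
set_option linter.dupNamespace false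
set_option maxSynthPendingDepth 3

open Set Function Filter Metric
open scoped Manifold ContDiff Topology

namespace Summit.SmoothPoincare4.SmoothPoincare4.Theorems.MargerinRails

open Literature.Geometry.Riemannian
open Literature.Geometry.Lorentzian Literature.Geometry.Lorentzian.PseudoRiemannianMetric

/-! ### Analysis: smooth limits along `𝓝[<] T` of families uniformly Cauchy in every `Cᵐ` -/

section Analysis

variable {P : Type*} [NormedAddCommGroup P] [NormedSpace ℝ P] {G : Type*} [NormedAddCommGroup G]

/-- From "`ε`–`t₂`" Cauchy control as `t ↑ T` to a uniformly Cauchy family along `𝓝[<] T`.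
[cite: Hamilton1982, §17, Cor. 17.10] -/
theorem uniformCauchySeqOn_nhdsLT_of_forall {X : Type*} {F : ℝ → X → G} {s : Set X} {T t₁ : ℝ}
    (h : ∀ ε : ℝ, 0 < ε → ∃ t₂ ∈ Ico t₁ T, ∀ t ∈ Ico t₂ T, ∀ t' ∈ Ico t₂ T, ∀ y ∈ s,
      ‖F t y - F t' y‖ ≤ ε) :
    UniformCauchySeqOn F (𝓝[<] T) s := by
  intro u hu
  obtain ⟨ε, hε, hεu⟩ := Metric.mem_uniformity_dist.1 hu
  obtain ⟨t₂, ht₂, hb⟩ := h (ε / 2) (half_pos hε)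
  have hmem : Ico t₂ T ∈ 𝓝[<] T := Ico_mem_nhdsLT ht₂.2
  filter_upwards [prod_mem_prod hmem hmem] with p hp y hy
  exact hεu (by rw [dist_eq_norm]; linarith [hb p.1 hp.1 p.2 hp.2 y hy])

/-- "Eventually as `t ↑ T`" (`0 < T`) means: on some `[t₂, T)` with `t₂ ∈ [0, T)`.
[cite: Hamilton1982, §17, Cor. 17.10] -/
theorem exists_Ico_of_eventually_nhdsLT {T : ℝ} (hT : 0 < T) {p : ℝ → Prop}
    (h : ∀ᶠ t in 𝓝[<] T, p t) : ∃ t₂ ∈ Ico 0 T, ∀ t ∈ Ico t₂ T, p t := by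
  obtain ⟨l, hlT, hl⟩ := mem_nhdsLT_iff_exists_Ioo_subset.1 h
  have hlT' : l < T := hlT
  refine ⟨max 0 ((l + T) / 2), ⟨le_max_left _ _, max_lt hT (by linarith)⟩, fun t ht ↦ hl ⟨?_, ht.2⟩⟩
  exact lt_of_lt_of_le (by linarith) ((le_max_right _ _).trans ht.1)

variable [NormedSpace ℝ G] [CompleteSpace G]

/-- **Smooth limits of families uniformly Cauchy in every `Cᵐ`** (Dieudonné (8.6.3), iterated —
the tree's `Literature.Analysis.Calculus.ContDiffUniformLimit` — along the filter `𝓝[<] T`): if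
the `F t` are `C^∞` on the open set `U` and, for every `m`, the derivatives `D^m (F t)` are
uniformly Cauchy on `U` as `t ↑ T`, then there is a `C^∞` map `G₀` on `U` with `F t → G₀`
pointwise on `U` and `D^m (F t) → D^m G₀` uniformly on `U`, for every `m`. This is the analysis
behind "the metrics converge in `C^∞` to a smooth limit metric".
[cite: Hamilton1982, §14, Lemma 14.2] -/
theorem exists_contDiffOn_limit_of_uniformCauchySeqOn {U : Set P} (hU : IsOpen U)
    {F : ℝ → P → G} {T : ℝ} (hF : ∀ t, ContDiffOn ℝ ∞ (F t) U)
    (hc : ∀ m : ℕ, UniformCauchySeqOn (fun t ↦ iteratedFDeriv ℝ m (F t)) (𝓝[<] T) U) :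
    ∃ G₀ : P → G, ContDiffOn ℝ ∞ G₀ U ∧
      (∀ y ∈ U, Tendsto (fun t ↦ F t y) (𝓝[<] T) (𝓝 (G₀ y))) ∧
      ∀ m : ℕ, TendstoUniformlyOn (fun t ↦ iteratedFDeriv ℝ m (F t)) (iteratedFDeriv ℝ m G₀)
        (𝓝[<] T) U := by
  obtain ⟨G₀, p, -, hpt, hlim⟩ :=
    Literature.Analysis.Calculus.exists_tendstoUniformlyOn_of_uniformCauchySeqOn_iteratedFDeriv
      (l := 𝓝[<] T) (N := (⊤ : ℕ∞)) (f := F) (U := U) (fun m _ ↦ hc m)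
  refine ⟨G₀, Literature.Analysis.Calculus.contDiffOn_of_tendstoUniformlyOn_iteratedFDeriv hU hF
    hlim hpt, hpt, fun m ↦ ?_⟩
  exact Literature.Analysis.Calculus.tendstoUniformlyOn_iteratedFDeriv_of_tendstoUniformlyOn hU
    hF hlim hpt (m := m) (by exact_mod_cast le_top)

end Analysis

/-! ### Geometry: the limit field of bilinear forms and its chart representatives -/

section Geometry

variable {E : Type*} [NormedAddCommGroup E] [NormedSpace ℝ E] {H : Type*} [TopologicalSpace H]
  {I : ModelWithCorners ℝ E H} {M : Type*} [TopologicalSpace M] [ChartedSpace H M]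
  [IsManifold I ∞ M]
  {g : ℝ → PseudoRiemannianMetric I ∞ E (TangentSpace I : M → Type _)} {l : Filter ℝ}

/-- **The limit field of bilinear forms** (as `limitVal` of `RicciFlowSmoothExtension.lean`, for
a rescaled family): if, at every point `x`, the rescaled Gram operators
`c(t) • gramOpFamily I g x (x, t)` converge along `l` to `A x`, then the forms
`v_x = A x ∘ (e_x × e_x)` (`e_x` the trivialization of `TM` at `x`, read at `x`) have the
coefficients `v_x(X, Y) = lim c(t) g_t(x)(X, Y)`. [cite: Topping2006, §5.3, p. 47] -/
theorem exists_field_of_tendsto_gramOpFamily (c : ℝ → ℝ) (A : M → E →L[ℝ] E →L[ℝ] ℝ)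
    (hA : ∀ x : M, Tendsto (fun t ↦ c t • gramOpFamily I g x (x, t)) l (𝓝 (A x))) :
    ∃ v : (x : M) → TangentSpace I x →L[ℝ] TangentSpace I x →L[ℝ] ℝ,
      ∀ (x : M) (X Y : TangentSpace I x),
        Tendsto (fun t ↦ c t * (g t).val x X Y) l (𝓝 (v x X Y)) := by
  refine ⟨fun x ↦ show TangentSpace I x →L[ℝ] TangentSpace I x →L[ℝ] ℝ from
    (ContinuousLinearMap.bilinearComp (A x)
      (show E →L[ℝ] E from
        (trivializationAt E (TangentSpace I : M → Type _) x).continuousLinearMapAt ℝ x)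
      (show E →L[ℝ] E from
        (trivializationAt E (TangentSpace I : M → Type _) x).continuousLinearMapAt ℝ x) :
      E →L[ℝ] E →L[ℝ] ℝ), fun x X Y ↦ ?_⟩
  have h := tendsto_apply₂_of_tendsto (hA x)
    ((trivializationAt E (TangentSpace I : M → Type _) x).continuousLinearMapAt ℝ x X)
    ((trivializationAt E (TangentSpace I : M → Type _) x).continuousLinearMapAt ℝ x Y)
  simp only [_root_.smul_apply, gramOpFamily_apply_continuousLinearMapAt, smul_eq_mul] at h
  exact h

variable [l.NeBot]

/-- **The representative of the limit field in any chart is the limit of the scaled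
representatives**: if `v_x(X, Y) = lim c(t) g_t(x)(X, Y)` everywhere and `c(t) • G_t(y) → L` in
the chart at `z`, then `chartRepRaw v z · y = L` (entries are fixed linear functions of the
coefficients at `Φ y`; limits are unique). [cite: Topping2006, §5.3, p. 47] -/
theorem chartRepRaw_eq_of_tendsto {c : ℝ → ℝ}
    {v : (x : M) → TangentSpace I x →L[ℝ] TangentSpace I x →L[ℝ] ℝ}
    (hv : ∀ (x : M) (X Y : TangentSpace I x), Tendsto (fun t ↦ c t * (g t).val x X Y) l (𝓝 (v x X Y)))
    {z : M} {y : E} {L : E →L[ℝ] E →L[ℝ] ℝ}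
    (hL : Tendsto (fun t ↦ c t • chartRep I g z t y) l (𝓝 L)) (s : ℝ) :
    chartRepRaw (fun (_ : ℝ) (b : M) ↦ v b) z s y = L := by
  ext a b
  rw [chartRepRaw_apply]
  exact tendsto_nhds_unique (hv _ _ _) (tendsto_apply₂_of_tendsto hL a b)

/-- **Positivity of the limit field** from a uniform lower bound at the centre of the chart:
if eventually `λ‖w‖² ≤ c(t) G_t(x̂)(w, w)` for all `w` (`λ > 0`, `x̂ = extChartAt I x x`), then
`v_x(X, X) > 0` for `X ≠ 0`. [cite: Hamilton1982, §14, Lemma 14.2] -/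
theorem pos_of_tendsto_of_lowerBound {c : ℝ → ℝ}
    {v : (x : M) → TangentSpace I x →L[ℝ] TangentSpace I x →L[ℝ] ℝ}
    (hv : ∀ (x : M) (X Y : TangentSpace I x), Tendsto (fun t ↦ c t * (g t).val x X Y) l (𝓝 (v x X Y)))
    (x : M) {lam : ℝ} (hlam : 0 < lam)
    (hpos : ∀ᶠ t in l, ∀ w : E, lam * ‖w‖ ^ 2 ≤ c t * chartRep I g x t (extChartAt I x x) w w)
    {X : TangentSpace I x} (hX : X ≠ 0) : 0 < v x X X := by
  have hx : x ∈ (trivializationAt E (TangentSpace I : M → Type _) x).baseSet :=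
    FiberBundle.mem_baseSet_trivializationAt E (TangentSpace I : M → Type _) x
  set w : E := (trivializationAt E (TangentSpace I : M → Type _) x).continuousLinearMapAt ℝ x X
    with hw_def
  have hw : w ≠ 0 := by
    intro hw0
    apply hX
    rw [← (trivializationAt E (TangentSpace I : M → Type _) x).symmL_continuousLinearMapAt
      (R := ℝ) hx X, ← hw_def, hw0, map_zero]
  have hle : lam * ‖w‖ ^ 2 ≤ v x X X := by
    refine ge_of_tendsto (hv x X X) ?_
    filter_upwards [hpos] with t ht
    have h := ht w
    rwa [hw_def, chartRep_extChartAt_self, gramOpFamily_apply_continuousLinearMapAt] at h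
  have hwn : 0 < ‖w‖ := norm_pos_iff.2 hw
  exact lt_of_lt_of_le (by positivity) hle

omit [l.NeBot] in
/-- **Smoothness of a field of bilinear forms whose chart representatives are smooth near the
centres** (the local chart criterion `contMDiffOn_totalSpaceMk_of_chartRepRaw`, Topping 2006,
§1.2.3, for a time-independent field). [cite: Topping2006, §1.2.3] -/
theorem contMDiff_totalSpaceMk_of_chartRepRaw_eqOn
    (v : (x : M) → TangentSpace I x →L[ℝ] TangentSpace I x →L[ℝ] ℝ)
    (h : ∀ z : M, ∃ U ∈ 𝓝 (extChartAt I z z), ∃ G₀ : E → (E →L[ℝ] E →L[ℝ] ℝ),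
      ContDiffOn ℝ ∞ G₀ U ∧ ∀ y ∈ U, chartRepRaw (fun (_ : ℝ) (b : M) ↦ v b) z 0 y = G₀ y) :
    ContMDiff I (I.prod 𝓘(ℝ, E →L[ℝ] E →L[ℝ] ℝ)) ∞
      (fun b : M ↦ Bundle.TotalSpace.mk' (E →L[ℝ] E →L[ℝ] ℝ)
        (E := fun b : M ↦ TangentSpace I b →L[ℝ] TangentSpace I b →L[ℝ] ℝ) b (v b)) := by
  have hfam := contMDiffOn_totalSpaceMk_of_chartRepRaw (I := I) (S := (univ : Set ℝ))
    (fun (_ : ℝ) (b : M) ↦ v b) fun z ↦ by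
      obtain ⟨U, hU, G₀, hG₀, heq⟩ := h z
      refine ⟨U, hU, ?_⟩
      have h1 : ContDiffOn ℝ ∞ (fun q : E × ℝ ↦ G₀ q.1) (U ×ˢ (univ : Set ℝ)) :=
        hG₀.comp contDiffOn_fst fun q hq ↦ hq.1
      exact h1.congr fun q hq ↦ heq q.1 hq.1
  have hι : ContMDiff I (I.prod 𝓘(ℝ, ℝ)) ∞ (fun b : M ↦ ((b, (0 : ℝ)) : M × ℝ)) :=
    contMDiff_id.prodMk contMDiff_const
  exact hfam.comp_contMDiff hι fun b ↦ ⟨mem_univ _, mem_univ _⟩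

end Geometry

/-! ### The smooth limit metric -/

section LimitMetric

variable {E : Type*} [NormedAddCommGroup E] [NormedSpace ℝ E] [FiniteDimensional ℝ E]
  {H : Type*} [TopologicalSpace H] {I : ModelWithCorners ℝ E H}
  {M : Type*} [TopologicalSpace M] [ChartedSpace H M] [IsManifold I ∞ M]
  {g : ℝ → PseudoRiemannianMetric I ∞ E (TangentSpace I : M → Type _)} {T : ℝ}

/-- **The smooth limit metric of a family whose scaled chart representatives are uniformly
positive and uniformly Cauchy in every `Cᵐ`** (Hamilton 1982, Lemma 14.2 / Cor. 17.10; Topping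
2006, p. 47, for the scaled family `g(t)/(T − t)`): there is a `C^∞` Riemannian metric `g'` with
`D^m [(T − t)⁻¹ G_t] → D^m [chartRep g' z]` uniformly on `B(ẑ, r)` as `t ↑ T`, every `m`, every
`z`. [cite: Hamilton1982, §14, Lemma 14.2] [cite: Hamilton1982, §17, Cor. 17.10]
[cite: Topping2006, §5.3, p. 47] -/
theorem exists_scaledLimit_metric (hT : 0 < T)
    (hbounds : ∀ z : M, ∃ r t₁ lam : ℝ, 0 < r ∧ t₁ ∈ Ico 0 T ∧ 0 < lam ∧
      closedBall (extChartAt I z z) r ⊆ (extChartAt I z).target ∧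
      (∀ t ∈ Ico t₁ T, ∀ y ∈ closedBall (extChartAt I z z) r, ∀ v : E,
        lam * ‖v‖ ^ 2 ≤ (T - t)⁻¹ * chartRep I g z t y v v) ∧
      (∀ m : ℕ, ∀ ε : ℝ, 0 < ε → ∃ t₂ ∈ Ico t₁ T, ∀ t ∈ Ico t₂ T, ∀ t' ∈ Ico t₂ T,
        ∀ y ∈ ball (extChartAt I z z) r,
          ‖iteratedFDeriv ℝ m (fun y : E ↦ (T - t)⁻¹ • chartRep I g z t y) y -
            iteratedFDeriv ℝ m (fun y : E ↦ (T - t')⁻¹ • chartRep I g z t' y) y‖ ≤ ε)) :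
    ∃ g' : PseudoRiemannianMetric I ∞ E (TangentSpace I : M → Type _), g'.IsRiemannian ∧
      ∀ z : M, ∃ r : ℝ, 0 < r ∧ closedBall (extChartAt I z z) r ⊆ (extChartAt I z).target ∧
        ∀ m : ℕ, ∀ ε : ℝ, 0 < ε → ∃ t₂ ∈ Ico 0 T, ∀ t ∈ Ico t₂ T,
          ∀ y ∈ ball (extChartAt I z z) r,
            ‖iteratedFDeriv ℝ m (fun y : E ↦ (T - t)⁻¹ • chartRep I g z t y) y -
              iteratedFDeriv ℝ m (fun y : E ↦ chartRep I (fun _ : ℝ ↦ g') z 0 y) y‖ ≤ ε := by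
  choose r t₁ lam hr ht₁ hlam hball hpos hcauchy using hbounds
  have hballsub : ∀ z, ball (extChartAt I z z) (r z) ⊆ (extChartAt I z).target :=
    fun z ↦ ball_subset_closedBall.trans (hball z)
  -- (1) the smooth limits of the scaled representatives, chart by chart
  have hlimit : ∀ z : M, ∃ G₀ : E → (E →L[ℝ] E →L[ℝ] ℝ),
      ContDiffOn ℝ ∞ G₀ (ball (extChartAt I z z) (r z)) ∧
      (∀ y ∈ ball (extChartAt I z z) (r z),
        Tendsto (fun t ↦ (T - t)⁻¹ • chartRep I g z t y) (𝓝[<] T) (𝓝 (G₀ y))) ∧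
      ∀ m : ℕ, TendstoUniformlyOn
        (fun t ↦ iteratedFDeriv ℝ m (fun y : E ↦ (T - t)⁻¹ • chartRep I g z t y))
        (iteratedFDeriv ℝ m G₀) (𝓝[<] T) (ball (extChartAt I z z) (r z)) := fun z ↦
    exists_contDiffOn_limit_of_uniformCauchySeqOn isOpen_ball
      (F := fun t y ↦ (T - t)⁻¹ • chartRep I g z t y)
      (fun t ↦ ((contDiffOn_chartRep_const (g t) z).mono (hballsub z)).const_smul (T - t)⁻¹)
      (fun m ↦ uniformCauchySeqOn_nhdsLT_of_forall (hcauchy z m))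
  choose G hGsm hGpt hGunif using hlimit
  -- (2) the limit field `v` and its coefficients
  obtain ⟨v, hv⟩ : ∃ v : (x : M) → TangentSpace I x →L[ℝ] TangentSpace I x →L[ℝ] ℝ,
      ∀ (x : M) (X Y : TangentSpace I x),
        Tendsto (fun t ↦ (T - t)⁻¹ * (g t).val x X Y) (𝓝[<] T) (𝓝 (v x X Y)) := by
    refine exists_field_of_tendsto_gramOpFamily (fun t ↦ (T - t)⁻¹)
      (fun x ↦ G x (extChartAt I x x)) fun x ↦ ?_
    have h := hGpt x (extChartAt I x x) (mem_ball_self (hr x))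
    simp only [chartRep_extChartAt_self] at h
    exact h
  -- (3) the representatives of `v` are the limits `G z` on the balls
  have hGeq : ∀ z : M, ∀ y ∈ ball (extChartAt I z z) (r z), ∀ s : ℝ,
      chartRepRaw (fun (_ : ℝ) (b : M) ↦ v b) z s y = G z y :=
    fun z y hy s ↦ chartRepRaw_eq_of_tendsto hv (hGpt z y hy) s
  -- (4) the metric
  have hsymm : ∀ (x : M) (X Y : TangentSpace I x), v x X Y = v x Y X := fun x X Y ↦ by
    refine tendsto_nhds_unique (hv x X Y) ?_
    have h := hv x Y X
    simp only [(g _).symm x Y X] at h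
    exact h
  have hvpos : ∀ (x : M) (X : TangentSpace I x), X ≠ 0 → 0 < v x X X := fun x X hX ↦ by
    refine pos_of_tendsto_of_lowerBound hv x (hlam x) ?_ hX
    filter_upwards [Ico_mem_nhdsLT (ht₁ x).2] with t ht
    exact hpos x t ht _ (mem_closedBall_self (hr x).le)
  have hsmooth := contMDiff_totalSpaceMk_of_chartRepRaw_eqOn v fun z ↦
    ⟨ball (extChartAt I z z) (r z), ball_mem_nhds _ (hr z), G z, hGsm z,
      fun y hy ↦ hGeq z y hy 0⟩
  let g' : PseudoRiemannianMetric I ∞ E (TangentSpace I : M → Type _) :=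
    { val := v
      symm := hsymm
      nondegenerate := fun b X hX ↦ by
        by_contra hne
        exact (hvpos b X hne).ne' (hX X)
      contMDiff := hsmooth }
  have hg'val : g'.val = v := rfl
  -- (5) the representative of `g'` in the chart at `z` is `G z` on the ball
  have hrep : ∀ z : M, ∀ y ∈ ball (extChartAt I z z) (r z),
      chartRep I (fun _ : ℝ ↦ g') z 0 y = G z y := fun z y hy ↦ by
    rw [← hGeq z y hy 0]
    ext a b
    simp only [chartRep_eq_chartRepRaw, chartRepRaw_apply, hg'val]
  refine ⟨g', fun b X hX ↦ hvpos b X hX, fun z ↦ ⟨r z, hr z, hball z, fun m ε hε ↦ ?_⟩⟩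
  obtain ⟨t₂, ht₂, hP⟩ := exists_Ico_of_eventually_nhdsLT hT
    (Metric.tendstoUniformlyOn_iff.1 (hGunif z m) ε hε)
  refine ⟨t₂, ht₂, fun t ht y hy ↦ ?_⟩
  have hEq : (fun y : E ↦ chartRep I (fun _ : ℝ ↦ g') z 0 y) =ᶠ[𝓝 y] G z := by
    filter_upwards [isOpen_ball.mem_nhds hy] with y' hy' using hrep z y' hy'
  rw [(hEq.iteratedFDeriv ℝ m).eq_of_nhds, ← dist_eq_norm, dist_comm]
  exact (hP t ht y hy).le

end LimitMetric

/-- **HELPER `helper_scaledLimit_metric` — the smooth limit metric `g' = lim g(t)/(T − t)`**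
(layer S5a of `stub_smoothRoundLimit`; Hamilton 1982, §14, Lemma 14.2 and §17, Cor. 17.10;
Topping 2006, p. 47): along a Ricci flow of Riemannian metrics on `[0, T)` on a closed manifold
with `4`-dimensional model, if the scaled chart representatives `(T − t)⁻¹ G_t` are, near every
point, uniformly positive definite, bounded in every `Cᵐ` and uniformly Cauchy in every `Cᵐ` as
`t ↑ T` (the conclusion of `helper_scaledChart_bounds`), then there is a `C^∞` Riemannian metric
`g'` on `M` to whose chart representatives the scaled representatives converge with all
derivatives, uniformly on a ball about every chart centre (`exists_scaledLimit_metric`).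
[cite: Hamilton1982, §14, Lemma 14.2] [cite: Hamilton1982, §17, Cor. 17.10]
[cite: Topping2006, §5.3, p. 47] -/
theorem helper_scaledLimit_metric : ∀ (M : Type) [TopologicalSpace M] [T2Space M] [SecondCountableTopology M] [ChartedSpace (EuclideanSpace ℝ (Fin 4)) M] [IsManifold (𝓡 4) ∞ M] [CompactSpace M] (g : ℝ → PseudoRiemannianMetric (𝓡 4) ∞ (EuclideanSpace ℝ (Fin 4)) (TangentSpace (𝓡 4) : M → Type _)) (cov : ℝ → CovariantDerivative (𝓡 4) (EuclideanSpace ℝ (Fin 4)) (TangentSpace (𝓡 4) : M → Type _)) (T : ℝ), 0 < T → IsRicciFlow g cov (Ico 0 T) → (∀ t ∈ Ico 0 T, (g t).IsRiemannian) → (∀ z : M, ∃ r t₁ lam : ℝ, 0 < r ∧ t₁ ∈ Ico 0 T ∧ 0 < lam ∧ Metric.closedBall (extChartAt (𝓡 4) z z) r ⊆ (extChartAt (𝓡 4) z).target ∧ (∀ t ∈ Ico t₁ T, ∀ y ∈ Metric.closedBall (extChartAt (𝓡 4) z z) r, ∀ v : EuclideanSpace ℝ (Fin 4), lam * ‖v‖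 ^ 2 ≤ (T - t)⁻¹ * chartRep (𝓡 4) g z t y v v) ∧ (∀ m : ℕ, ∃ Cm : ℝ, ∀ t ∈ Ico t₁ T, ∀ y ∈ Metric.ball (extChartAt (𝓡 4) z z) r, ‖iteratedFDeriv ℝ m (fun y : EuclideanSpace ℝ (Fin 4) ↦ (T - t)⁻¹ • chartRep (𝓡 4) g z t y) y‖ ≤ Cm) ∧ (∀ m : ℕ, ∀ ε : ℝ, 0 < ε → ∃ t₂ ∈ Ico t₁ T, ∀ t ∈ Ico t₂ T, ∀ t' ∈ Ico t₂ T, ∀ y ∈ Metric.ball (extChartAt (𝓡 4) z z) r, ‖iteratedFDeriv ℝ m (fun y : EuclideanSpace ℝ (Fin 4) ↦ (T - t)⁻¹ • chartRep (𝓡 4) g z t y) y - iteratedFDeriv ℝ m (fun y : EuclideanSpace ℝ (Fin 4) ↦ (T - t')⁻¹ • chartRep (𝓡 4) g z t' y) y‖ ≤ ε)) → ∃ g' : PseudoRiemannianMetric (𝓡 4) ∞ (EuclideanSpace ℝ (Fin 4)) (TangentSpace (𝓡 4) : M → Type _), g'.IsRiemannian ∧ ∀ z : M, ∃ r : ℝ,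 0 < r ∧ Metric.closedBall (extChartAt (𝓡 4) z z) r ⊆ (extChartAt (𝓡 4) z).target ∧ ∀ m : ℕ, ∀ ε : ℝ, 0 < ε → ∃ t₂ ∈ Ico 0 T, ∀ t ∈ Ico t₂ T, ∀ y ∈ Metric.ball (extChartAt (𝓡 4) z z) r, ‖iteratedFDeriv ℝ m (fun y : EuclideanSpace ℝ (Fin 4) ↦ (T - t)⁻¹ • chartRep (𝓡 4) g z t y) y - iteratedFDeriv ℝ m (fun y : EuclideanSpace ℝ (Fin 4) ↦ chartRep (𝓡 4) (fun _ : ℝ ↦ g') z 0 y) y‖ ≤ ε := by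
  intro M _ _ _ _ _ _ g cov T hT _ _ hbounds
  refine exists_scaledLimit_metric hT fun z ↦ ?_
  obtain ⟨r, t₁, lam, hr, ht₁, hlam, hball, hpos, -, hcauchy⟩ := hbounds z
  exact ⟨r, t₁, lam, hr, ht₁, hlam, hball, hpos, hcauchy⟩

end Summit.SmoothPoincare4.SmoothPoincare4.Theorems.MargerinRails

end
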